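import Literature.MathematicalPhysics.QuantumLattice.FinDimSpectrumProofs
import HarnessLib

/-!
# Fröhlich–Lieb's principle of exponential localization of eigenvectors
# (Comm. Math. Phys. 60 (1978), §III.A, Theorem 3.1 and Corollary 3.2)

Topic `MathematicalPhysics/QuantumLattice` (finite-dimensional linear algebra in the matrix
language of the tree's spin systems). Fröhlich–Lieb, Thm. 3.1: let `A ≥ 0` and `B` be Hermitian
with `±B ≤ εA`, `0 ≤ ε < 1`; let `(A + B)ψ = λψ`, `‖ψ‖ = 1`, and `ρ > λ ≥ 0` with
`σ = ερ/(ρ - λ) < 1`; let `M_ρ` be the range of the spectral projection `P_ρ` of `A` for `[ρ, ∞)`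
and `φ ∈ M_ρ` a unit vector with `{B(A - λ)⁻¹}ʲ φ ∈ M_ρ` for `j = 0, …, d - 1` (`d ≥ 1`), where
`(A - λ)⁻¹` is the inverse of `A - λ > 0` on `M_ρ`. Then `|⟨φ, ψ⟩| ≤ σ^d` ("eigenvectors of
`A + B` with low energy are exponentially small on the high-`A`-energy subspace, in the number of
`B`-steps needed to reach it"). Cor. 3.2: for the projection `P_N` onto a subspace `N ⊆ M_ρ` all of
whose vectors satisfy the hypothesis, `⟨ψ, P_N ψ⟩ ≤ σ^{2d}`. This is the tool by which FL bound the
overlap `Cᵢ = ⟨φᵢ, P_Λ φᵢ⟩` of the universal projection with the low-lying eigenvectors of the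
quantum models ((3.18)–(3.20)), i.e. the quantum replacement of the classical constrained-energy
estimate (`ConstrainedBoltzmannWeightBound`).

* `IsHermitian.spectralProjGe hA ρ` — `P_ρ = 𝟙[A ≥ ρ]`; `IsHermitian.resolventGe hA ρ λ` — the
  operator `(A - λ)⁻¹ P_ρ` (`= (A - λ)⁻¹` on `M_ρ`, `0` on `M_ρ^⊥`);
* `two_mul_re_le_of_pm_le`, **`two_mul_norm_le_of_pm_le`** — the form bound behind FL's use
  of hypothesis (ii): `±B ≤ εA ⇒ 2|⟨u, Bw⟩| ≤ ε(s²⟨u,Au⟩ + s⁻²⟨w,Aw⟩)` for every `s ≠ 0` (proved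
  by AM–GM in an eigenbasis; it replaces FL's `‖A^{-1/2}BA^{-1/2}‖ ≤ ε`, which needs `A > 0`);
* **`FrohlichLieb_exponentialLocalization`** — Thm. 3.1 as printed;
* **`FrohlichLieb_exponentialLocalization_proj`** — Cor. 3.2.

The proof follows FL (3.12)–(3.17) with the square roots removed: (3.12) `⟨χ, ψ⟩ = -⟨Rχ, Bψ⟩`
for `χ ∈ M_ρ` (`R = (A-λ)⁻¹P_ρ`), iterated `d - 1` times along hypothesis (iii); the contraction
(3.15) in the form `⟨Tχ, R Tχ⟩ ≤ σ²⟨χ, Rχ⟩` (`T = BR`); (3.14), (3.16), (3.17) as stated.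
No named facts; no sorries.

## References

* J. Fröhlich, E. H. Lieb, *Phase transitions in anisotropic lattice spin systems*, Comm. Math.
  Phys. **60** (1978) 233–267, §III.A, Thm. 3.1, eqs. (3.9)–(3.17), Cor. 3.2. [FrohlichLieb1978]
-/

noncomputable section

open Matrix Finset
open scoped ComplexOrder MatrixOrder BigOperators

namespace Matrix

variable {n : Type*} [Fintype n] [DecidableEq n]

/-! ### Sesquilinear bookkeeping -/

omit [DecidableEq n] in
/-- `⟨Mv, w⟩ = ⟨v, Mᴴ w⟩`. [folklore] -/
private theorem fel_star_mulVec_dotProduct (M : Matrix n n ℂ) (v w : n → ℂ) :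
    star (M *ᵥ v) ⬝ᵥ w = star v ⬝ᵥ Mᴴ *ᵥ w := by
  rw [star_mulVec, ← dotProduct_mulVec]

omit [DecidableEq n] in
/-- `‖v‖² = Σ |vᵢ|²` as a complex number. [folklore] -/
private theorem fel_star_dotProduct_self (v : n → ℂ) :
    star v ⬝ᵥ v = ((∑ i, Complex.normSq (v i) : ℝ) : ℂ) := by
  rw [dotProduct, Complex.ofReal_sum]
  exact sum_congr rfl fun i _ => by
    rw [Pi.star_apply, Complex.star_def, Complex.normSq_eq_conj_mul_self]

omit [DecidableEq n] in
/-- A phase `c`, `|c| = 1`, in the first slot: `⟨c̄u, v⟩ = c⟨u, v⟩`. [folklore] -/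
private theorem fel_star_smul_dotProduct (c : ℂ) (u v : n → ℂ) :
    star (star c • u) ⬝ᵥ v = c * (star u ⬝ᵥ v) := by
  rw [star_smul, star_star, smul_dotProduct, smul_eq_mul]

/-! ### The eigenframe of a Hermitian matrix -/

section Frame

/-- `Uᴴ U = 1` for the eigenvector unitary. [folklore] -/
private theorem fel_UhU {A : Matrix n n ℂ} (hA : A.IsHermitian) :
    (hA.eigenvectorUnitary : Matrix n n ℂ)ᴴ * (hA.eigenvectorUnitary : Matrix n n ℂ) = 1 := by
  rw [← star_eq_conjTranspose]
  exact Unitary.star_mul_self_of_mem hA.eigenvectorUnitary.prop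

/-- `U Uᴴ = 1` for the eigenvector unitary. [folklore] -/
private theorem fel_UUh {A : Matrix n n ℂ} (hA : A.IsHermitian) :
    (hA.eigenvectorUnitary : Matrix n n ℂ) * (hA.eigenvectorUnitary : Matrix n n ℂ)ᴴ = 1 := by
  rw [← star_eq_conjTranspose]
  exact Unitary.mul_star_self_of_mem hA.eigenvectorUnitary.prop

/-- `f(A) = U diag(f(λᵢ)) Uᴴ`. [folklore] -/
private theorem fel_cfc_eq {A : Matrix n n ℂ} (hA : A.IsHermitian) (f : ℝ → ℝ) :
    hA.cfc f = (hA.eigenvectorUnitary : Matrix n n ℂ) *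
      diagonal (fun i => ((f (hA.eigenvalues i) : ℝ) : ℂ)) *
        (hA.eigenvectorUnitary : Matrix n n ℂ)ᴴ := by
  rw [IsHermitian.cfc, Unitary.conjStarAlgAut_apply, star_eq_conjTranspose]
  rfl

/-- `A = U diag(λᵢ) Uᴴ` (spectral theorem). [folklore] -/
private theorem fel_self_eq {A : Matrix n n ℂ} (hA : A.IsHermitian) :
    A = (hA.eigenvectorUnitary : Matrix n n ℂ) *
      diagonal (fun i => ((hA.eigenvalues i : ℝ) : ℂ)) *
        (hA.eigenvectorUnitary : Matrix n n ℂ)ᴴ := by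
  conv_lhs => rw [hA.spectral_theorem, Unitary.conjStarAlgAut_apply, star_eq_conjTranspose]
  rfl

/-- `(U diag g Uᴴ)(U diag h Uᴴ) = U diag(gh) Uᴴ`. [folklore] -/
private theorem fel_frame_mul {A : Matrix n n ℂ} (hA : A.IsHermitian) (g h : n → ℂ) :
    (hA.eigenvectorUnitary : Matrix n n ℂ) * diagonal g * (hA.eigenvectorUnitary : Matrix n n ℂ)ᴴ *
        ((hA.eigenvectorUnitary : Matrix n n ℂ) * diagonal h *
          (hA.eigenvectorUnitary : Matrix n n ℂ)ᴴ) =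
      (hA.eigenvectorUnitary : Matrix n n ℂ) * diagonal (fun i => g i * h i) *
        (hA.eigenvectorUnitary : Matrix n n ℂ)ᴴ := by
  set U : Matrix n n ℂ := (hA.eigenvectorUnitary : Matrix n n ℂ)
  simp only [Matrix.mul_assoc]
  rw [← Matrix.mul_assoc Uᴴ U, fel_UhU, Matrix.one_mul, ← Matrix.mul_assoc (diagonal g),
    diagonal_mul_diagonal]

/-- Frames with pointwise equal weights agree. [folklore] -/
private theorem fel_frame_congr {A : Matrix n n ℂ} (hA : A.IsHermitian) {g h : n → ℂ}
    (hgh : ∀ i, g i = h i) :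
    (hA.eigenvectorUnitary : Matrix n n ℂ) * diagonal g * (hA.eigenvectorUnitary : Matrix n n ℂ)ᴴ =
      (hA.eigenvectorUnitary : Matrix n n ℂ) * diagonal h *
        (hA.eigenvectorUnitary : Matrix n n ℂ)ᴴ := by
  rw [show g = h from funext hgh]

/-- `(U diag g Uᴴ)ᴴ = U diag(ḡ) Uᴴ`; in particular it is Hermitian for real `g`. [folklore] -/
private theorem fel_frame_isHermitian {A : Matrix n n ℂ} (hA : A.IsHermitian) (γ : n → ℝ) :
    ((hA.eigenvectorUnitary : Matrix n n ℂ) * diagonal (fun i => ((γ i : ℝ) : ℂ)) *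
      (hA.eigenvectorUnitary : Matrix n n ℂ)ᴴ).IsHermitian := by
  have hD : (diagonal fun i => ((γ i : ℝ) : ℂ)).IsHermitian := by
    rw [IsHermitian, diagonal_conjTranspose]
    congr 1
    funext i
    exact Complex.conj_ofReal _
  simpa only [conjTranspose_conjTranspose] using
    isHermitian_conjTranspose_mul_mul (hA.eigenvectorUnitary : Matrix n n ℂ)ᴴ hD

/-- **The sesquilinear form of `U diag g Uᴴ` in eigen-coordinates**:
`⟨x, U diag g Uᴴ y⟩ = Σᵢ gᵢ x̂ᵢ* ŷᵢ`, `x̂ = Uᴴx`. [folklore] -/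
private theorem fel_frame_form {A : Matrix n n ℂ} (hA : A.IsHermitian) (g : n → ℂ)
    (x y : n → ℂ) :
    star x ⬝ᵥ ((hA.eigenvectorUnitary : Matrix n n ℂ) * diagonal g *
        (hA.eigenvectorUnitary : Matrix n n ℂ)ᴴ) *ᵥ y =
      ∑ i, g i * (star (((hA.eigenvectorUnitary : Matrix n n ℂ)ᴴ *ᵥ x) i) *
        ((hA.eigenvectorUnitary : Matrix n n ℂ)ᴴ *ᵥ y) i) := by
  set U : Matrix n n ℂ := (hA.eigenvectorUnitary : Matrix n n ℂ)
  rw [← mulVec_mulVec, ← mulVec_mulVec]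
  have h1 : star x ⬝ᵥ U *ᵥ (diagonal g *ᵥ (Uᴴ *ᵥ y)) =
      star (Uᴴ *ᵥ x) ⬝ᵥ (diagonal g *ᵥ (Uᴴ *ᵥ y)) := by
    rw [fel_star_mulVec_dotProduct, conjTranspose_conjTranspose]
  rw [h1, dotProduct]
  exact sum_congr rfl fun i _ => by rw [mulVec_diagonal, Pi.star_apply]; ring

/-- The quadratic form of `U diag γ Uᴴ` (`γ` real): `⟨ξ, U diag γ Uᴴ ξ⟩ = Σᵢ γᵢ |ξ̂ᵢ|²`.
[folklore] -/
private theorem fel_frame_quad {A : Matrix n n ℂ} (hA : A.IsHermitian) (γ : n → ℝ)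
    (ξ : n → ℂ) :
    star ξ ⬝ᵥ ((hA.eigenvectorUnitary : Matrix n n ℂ) * diagonal (fun i => ((γ i : ℝ) : ℂ)) *
        (hA.eigenvectorUnitary : Matrix n n ℂ)ᴴ) *ᵥ ξ =
      ((∑ i, γ i * Complex.normSq (((hA.eigenvectorUnitary : Matrix n n ℂ)ᴴ *ᵥ ξ) i) : ℝ) : ℂ) := by
  rw [fel_frame_form, Complex.ofReal_sum]
  exact sum_congr rfl fun i _ => by
    rw [Complex.star_def, ← Complex.normSq_eq_conj_mul_self, Complex.ofReal_mul]

/-- `‖Uᴴξ‖² = ‖ξ‖²`. [folklore] -/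
private theorem fel_frame_norm {A : Matrix n n ℂ} (hA : A.IsHermitian) (ξ : n → ℂ) :
    (∑ i, Complex.normSq (((hA.eigenvectorUnitary : Matrix n n ℂ)ᴴ *ᵥ ξ) i) : ℝ) =
      (star ξ ⬝ᵥ ξ).re := by
  set U : Matrix n n ℂ := (hA.eigenvectorUnitary : Matrix n n ℂ)
  have h : star (Uᴴ *ᵥ ξ) ⬝ᵥ (Uᴴ *ᵥ ξ) = star ξ ⬝ᵥ ξ := by
    rw [fel_star_mulVec_dotProduct, conjTranspose_conjTranspose, mulVec_mulVec, fel_UUh, one_mulVec]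
  rw [← h, fel_star_dotProduct_self, Complex.ofReal_re]

end Frame

/-! ### The form bound from `±B ≤ εA` -/

/-- AM–GM form of the Cauchy–Schwarz inequality for a positive semidefinite matrix:
`2 Re⟨u, Qw⟩ ≤ s²⟨u, Qu⟩ + s⁻²⟨w, Qw⟩` for every real `s ≠ 0`. [folklore] -/
private theorem fel_two_mul_re_le_of_posSemidef {Q : Matrix n n ℂ} (hQ : Q.PosSemidef) (u w : n → ℂ)
    {s : ℝ} (hs : s ≠ 0) :
    2 * (star u ⬝ᵥ Q *ᵥ w).re ≤
      s ^ 2 * (star u ⬝ᵥ Q *ᵥ u).re + (s ^ 2)⁻¹ * (star w ⬝ᵥ Q *ᵥ w).re := by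
  have hQh : Q.IsHermitian := hQ.1
  set U : Matrix n n ℂ := (hQh.eigenvectorUnitary : Matrix n n ℂ) with hU
  set a : n → ℂ := Uᴴ *ᵥ u with ha
  set b : n → ℂ := Uᴴ *ᵥ w with hb
  have huw : (star u ⬝ᵥ Q *ᵥ w).re =
      ∑ i, hQh.eigenvalues i * ((a i).re * (b i).re + (a i).im * (b i).im) := by
    conv_lhs => rw [fel_self_eq hQh, fel_frame_form hQh]
    rw [Complex.re_sum]
    refine sum_congr rfl fun i _ => ?_
    rw [← hU, ← ha, ← hb, Complex.re_ofReal_mul, Complex.star_def, Complex.mul_re,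
      Complex.conj_re, Complex.conj_im]
    ring
  have huu : (star u ⬝ᵥ Q *ᵥ u).re = ∑ i, hQh.eigenvalues i * ((a i).re ^ 2 + (a i).im ^ 2) := by
    conv_lhs => rw [fel_self_eq hQh, fel_frame_quad hQh]
    rw [Complex.ofReal_re]
    refine sum_congr rfl fun i _ => ?_
    rw [← hU, ← ha, Complex.normSq_apply]
    ring
  have hww : (star w ⬝ᵥ Q *ᵥ w).re = ∑ i, hQh.eigenvalues i * ((b i).re ^ 2 + (b i).im ^ 2) := by
    conv_lhs => rw [fel_self_eq hQh, fel_frame_quad hQh]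
    rw [Complex.ofReal_re]
    refine sum_congr rfl fun i _ => ?_
    rw [← hU, ← hb, Complex.normSq_apply]
    ring
  rw [huw, huu, hww, mul_sum, mul_sum, mul_sum, ← sum_add_distrib]
  refine sum_le_sum fun i _ => ?_
  have hq : 0 ≤ hQh.eigenvalues i := hQ.eigenvalues_nonneg i
  have hss : s * s⁻¹ = 1 := mul_inv_cancel₀ hs
  have key : s ^ 2 * (hQh.eigenvalues i * ((a i).re ^ 2 + (a i).im ^ 2)) +
      (s ^ 2)⁻¹ * (hQh.eigenvalues i * ((b i).re ^ 2 + (b i).im ^ 2)) -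
      2 * (hQh.eigenvalues i * ((a i).re * (b i).re + (a i).im * (b i).im)) =
      hQh.eigenvalues i * ((s * (a i).re - s⁻¹ * (b i).re) ^ 2 +
        (s * (a i).im - s⁻¹ * (b i).im) ^ 2) := by
    rw [← inv_pow]
    linear_combination (2 * hQh.eigenvalues i * ((a i).re * (b i).re + (a i).im * (b i).im)) * hss
  nlinarith [mul_nonneg hq (add_nonneg (sq_nonneg (s * (a i).re - s⁻¹ * (b i).re))
    (sq_nonneg (s * (a i).im - s⁻¹ * (b i).im))), key]

/-- The real-part version of the form bound: `±B ≤ εA ⇒ 2 Re⟨u, Bw⟩ ≤ ε(s²⟨u,Au⟩ + s⁻²⟨w,Aw⟩)`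
(`s ≠ 0`). [cite: FrohlichLieb1978, §III.A hypothesis (ii), eqs. (3.14)–(3.15)] -/
theorem two_mul_re_le_of_pm_le {A B : Matrix n n ℂ} {ε : ℝ} (hBp : ((ε : ℂ) • A - B).PosSemidef)
    (hBm : ((ε : ℂ) • A + B).PosSemidef) (u w : n → ℂ) {s : ℝ} (hs : s ≠ 0) :
    2 * (star u ⬝ᵥ B *ᵥ w).re ≤
      ε * (s ^ 2 * (star u ⬝ᵥ A *ᵥ u).re + (s ^ 2)⁻¹ * (star w ⬝ᵥ A *ᵥ w).re) := by
  have h1 := fel_two_mul_re_le_of_posSemidef hBm u w hs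
  have h2 := fel_two_mul_re_le_of_posSemidef hBp u (-w) (s := s) hs
  have eform : ∀ x y : n → ℂ, (star x ⬝ᵥ ((ε : ℂ) • A + B) *ᵥ y).re =
      ε * (star x ⬝ᵥ A *ᵥ y).re + (star x ⬝ᵥ B *ᵥ y).re := by
    intro x y
    rw [add_mulVec, smul_mulVec, dotProduct_add, dotProduct_smul, Complex.add_re, smul_eq_mul,
      Complex.re_ofReal_mul]
  have eform' : ∀ x y : n → ℂ, (star x ⬝ᵥ ((ε : ℂ) • A - B) *ᵥ y).re =
      ε * (star x ⬝ᵥ A *ᵥ y).re - (star x ⬝ᵥ B *ᵥ y).re := by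
    intro x y
    rw [sub_mulVec, smul_mulVec, dotProduct_sub, dotProduct_smul, Complex.sub_re, smul_eq_mul,
      Complex.re_ofReal_mul]
  rw [eform, eform, eform] at h1
  rw [eform', eform', eform'] at h2
  simp only [mulVec_neg, dotProduct_neg, Complex.neg_re, star_neg, neg_dotProduct, neg_neg] at h2
  nlinarith [h1, h2]

/-- **The form bound `±B ≤ εA ⇒ 2|⟨u, Bw⟩| ≤ ε(s²⟨u, Au⟩ + s⁻²⟨w, Aw⟩)`** (`s ≠ 0` real) —
Fröhlich–Lieb's remark that hypothesis (ii) "is all we need": it is the square-root-free form of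
`‖A^{-1/2}BA^{-1/2}‖ ≤ ε`.
[cite: FrohlichLieb1978, §III.A hypothesis (ii), Remark 2, eqs. (3.14)–(3.15)] -/
theorem two_mul_norm_le_of_pm_le {A B : Matrix n n ℂ} {ε : ℝ} (hBp : ((ε : ℂ) • A - B).PosSemidef)
    (hBm : ((ε : ℂ) • A + B).PosSemidef) (u w : n → ℂ) {s : ℝ} (hs : s ≠ 0) :
    2 * ‖star u ⬝ᵥ B *ᵥ w‖ ≤
      ε * (s ^ 2 * (star u ⬝ᵥ A *ᵥ u).re + (s ^ 2)⁻¹ * (star w ⬝ᵥ A *ᵥ w).re) := by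
  set z : ℂ := star u ⬝ᵥ B *ᵥ w with hz
  by_cases h0 : z = 0
  · rw [h0, norm_zero, mul_zero]
    have h := two_mul_re_le_of_pm_le hBp hBm u w hs
    rw [← hz, h0, Complex.zero_re, mul_zero] at h
    exact h
  · -- rotate `u` by the phase of `z`
    set c : ℂ := star z / (‖z‖ : ℂ) with hc
    have hzn : (‖z‖ : ℂ) ≠ 0 := by exact_mod_cast norm_ne_zero_iff.2 h0
    have hcn : Complex.normSq c = 1 := by
      rw [hc, map_div₀, Complex.normSq_ofReal, Complex.star_def, Complex.normSq_conj,
        Complex.normSq_eq_norm_sq, ← sq, div_self (pow_ne_zero 2 (norm_ne_zero_iff.2 h0))]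
    have hcz : c * z = (‖z‖ : ℂ) := by
      rw [hc, div_mul_eq_mul_div, Complex.star_def, ← Complex.normSq_eq_conj_mul_self,
        Complex.normSq_eq_norm_sq, Complex.ofReal_pow, sq, mul_div_assoc, div_self hzn, mul_one]
    have h := two_mul_re_le_of_pm_le hBp hBm (star c • u) w hs
    rw [fel_star_smul_dotProduct, ← hz, hcz, Complex.ofReal_re] at h
    -- the rotated quadratic form is unchanged
    have hq : (star (star c • u) ⬝ᵥ A *ᵥ (star c • u)).re = (star u ⬝ᵥ A *ᵥ u).re := by
      rw [fel_star_smul_dotProduct, mulVec_smul, dotProduct_smul, smul_eq_mul, ← mul_assoc,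
        Complex.star_def, Complex.mul_conj, hcn, Complex.ofReal_one, one_mul]
    rw [hq] at h
    exact h

/-! ### The spectral projection `P_ρ` and the restricted resolvent `(A - λ)⁻¹ P_ρ` -/

section Spectral

/-- **The spectral projection `P_ρ` of a Hermitian `A` for `[ρ, ∞)`** (its range is FL's `M_ρ`,
"all eigenvectors of `A` corresponding to eigenvalues `≥ ρ`"). [cite: FrohlichLieb1978, Thm. 3.1] -/
def IsHermitian.spectralProjGe {A : Matrix n n ℂ} (hA : A.IsHermitian) (ρ : ℝ) :
    Matrix n n ℂ :=
  hA.cfc fun x => if ρ ≤ x then 1 else 0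

/-- **The restricted resolvent `(A - λ)⁻¹ P_ρ`**: the inverse of `A - λ` on `M_ρ` (where
`A - λ ≥ ρ - λ > 0`), extended by `0` on `M_ρ^⊥` — FL's `(A - λ)⁻¹` acting on `M_ρ`.
[cite: FrohlichLieb1978, Thm. 3.1, eq. (3.12)] -/
def IsHermitian.resolventGe {A : Matrix n n ℂ} (hA : A.IsHermitian) (ρ lam : ℝ) :
    Matrix n n ℂ :=
  hA.cfc fun x => if ρ ≤ x then (x - lam)⁻¹ else 0

/-- `P_ρ` is Hermitian. [cite: FrohlichLieb1978, Thm. 3.1] -/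
theorem IsHermitian.spectralProjGe_isHermitian {A : Matrix n n ℂ} (hA : A.IsHermitian) (ρ : ℝ) :
    (hA.spectralProjGe ρ).IsHermitian := by
  rw [IsHermitian.spectralProjGe, fel_cfc_eq]
  exact fel_frame_isHermitian hA _

/-- `(A - λ)⁻¹P_ρ` is Hermitian. [cite: FrohlichLieb1978, Thm. 3.1] -/
theorem IsHermitian.resolventGe_isHermitian {A : Matrix n n ℂ} (hA : A.IsHermitian) (ρ lam : ℝ) :
    (hA.resolventGe ρ lam).IsHermitian := by
  rw [IsHermitian.resolventGe, fel_cfc_eq]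
  exact fel_frame_isHermitian hA _

/-- `P_ρ² = P_ρ`. [cite: FrohlichLieb1978, Thm. 3.1] -/
theorem IsHermitian.spectralProjGe_mul_self {A : Matrix n n ℂ} (hA : A.IsHermitian) (ρ : ℝ) :
    hA.spectralProjGe ρ * hA.spectralProjGe ρ = hA.spectralProjGe ρ := by
  rw [IsHermitian.spectralProjGe, fel_cfc_eq, fel_frame_mul]
  exact fel_frame_congr hA fun i => by split_ifs <;> simp

/-- `(A - λ)·(A - λ)⁻¹P_ρ = P_ρ` (`λ < ρ`). [cite: FrohlichLieb1978, Thm. 3.1, eq. (3.12)] -/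
theorem IsHermitian.sub_mul_resolventGe {A : Matrix n n ℂ} (hA : A.IsHermitian) {ρ lam : ℝ}
    (hρ : lam < ρ) :
    (A - (lam : ℂ) • (1 : Matrix n n ℂ)) * hA.resolventGe ρ lam = hA.spectralProjGe ρ := by
  have hAl : A - (lam : ℂ) • (1 : Matrix n n ℂ) = (hA.eigenvectorUnitary : Matrix n n ℂ) *
      diagonal (fun i => (((hA.eigenvalues i - lam : ℝ)) : ℂ)) *
        (hA.eigenvectorUnitary : Matrix n n ℂ)ᴴ := by
    have hdiag : diagonal (fun _ : n => (lam : ℂ)) = (lam : ℂ) • (1 : Matrix n n ℂ) := by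
      ext i j
      rw [diagonal_apply, smul_apply, one_apply, smul_eq_mul, mul_ite, mul_one, mul_zero]
    have h1 : (lam : ℂ) • (1 : Matrix n n ℂ) = (hA.eigenvectorUnitary : Matrix n n ℂ) *
        diagonal (fun _ => (lam : ℂ)) * (hA.eigenvectorUnitary : Matrix n n ℂ)ᴴ := by
      rw [hdiag, Matrix.mul_smul, Matrix.mul_one, Matrix.smul_mul, fel_UUh]
    conv_lhs => rw [fel_self_eq hA, h1]
    rw [← Matrix.sub_mul, ← Matrix.mul_sub, diagonal_sub]
    exact fel_frame_congr hA fun i => by push_cast; ring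
  rw [hAl, IsHermitian.resolventGe, IsHermitian.spectralProjGe, fel_cfc_eq, fel_cfc_eq,
    fel_frame_mul]
  refine fel_frame_congr hA fun i => ?_
  split_ifs with h
  · have hne : (hA.eigenvalues i - lam : ℝ) ≠ 0 := by linarith
    rw [← Complex.ofReal_mul, mul_inv_cancel₀ hne, Complex.ofReal_one]
  · rw [Complex.ofReal_zero, mul_zero]

/-- **FL (3.12)**: for `χ ∈ M_ρ` and an eigenvector `(A + B)ψ = λψ`,
`⟨χ, ψ⟩ = -⟨(A-λ)⁻¹χ, Bψ⟩`. [cite: FrohlichLieb1978, eq. (3.12)] -/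
theorem IsHermitian.dotProduct_eq_neg_resolventGe {A : Matrix n n ℂ} (hA : A.IsHermitian)
    {B : Matrix n n ℂ} {ρ lam : ℝ} (hρ : lam < ρ)
    {ψ : n → ℂ} (hψ : (A + B) *ᵥ ψ = (lam : ℂ) • ψ) {χ : n → ℂ}
    (hχ : hA.spectralProjGe ρ *ᵥ χ = χ) :
    star χ ⬝ᵥ ψ = -(star (hA.resolventGe ρ lam *ᵥ χ) ⬝ᵥ B *ᵥ ψ) := by
  have hBψ : (A - (lam : ℂ) • (1 : Matrix n n ℂ)) *ᵥ ψ = -(B *ᵥ ψ) := by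
    rw [sub_mulVec, smul_mulVec, one_mulVec, eq_neg_iff_add_eq_zero, ← sub_eq_zero.2 hψ,
      add_mulVec]
    abel
  have hherm : (A - (lam : ℂ) • (1 : Matrix n n ℂ))ᴴ = A - (lam : ℂ) • (1 : Matrix n n ℂ) := by
    rw [conjTranspose_sub, hA.eq, conjTranspose_smul, conjTranspose_one, Complex.star_def,
      Complex.conj_ofReal]
  conv_lhs => rw [← hχ, ← hA.sub_mul_resolventGe hρ, ← mulVec_mulVec, fel_star_mulVec_dotProduct,
    hherm, hBψ, dotProduct_neg]

/-- `0 ≤ ⟨ξ, (A-λ)⁻¹P_ρ ξ⟩ ≤ (ρ - λ)⁻¹‖ξ‖²` (FL (3.16)). [cite: FrohlichLieb1978, eq. (3.16)] -/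
theorem IsHermitian.re_resolventGe_bounds {A : Matrix n n ℂ} (hA : A.IsHermitian) {ρ lam : ℝ}
    (hρ : lam < ρ) (ξ : n → ℂ) :
    0 ≤ (star ξ ⬝ᵥ hA.resolventGe ρ lam *ᵥ ξ).re ∧
      (star ξ ⬝ᵥ hA.resolventGe ρ lam *ᵥ ξ).re ≤ (ρ - lam)⁻¹ * (star ξ ⬝ᵥ ξ).re := by
  rw [IsHermitian.resolventGe, fel_cfc_eq, fel_frame_quad, Complex.ofReal_re, ← fel_frame_norm hA,
    mul_sum]
  constructor
  · refine sum_nonneg fun i _ => mul_nonneg ?_ (Complex.normSq_nonneg _)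
    split_ifs with h
    · exact inv_nonneg.2 (by linarith)
    · exact le_rfl
  · refine sum_le_sum fun i _ => mul_le_mul_of_nonneg_right ?_ (Complex.normSq_nonneg _)
    split_ifs with h
    · exact inv_anti₀ (by linarith) (by linarith)
    · exact inv_nonneg.2 (by linarith)

/-- `⟨Rξ, A Rξ⟩ ≤ ρ(ρ - λ)⁻¹ ⟨ξ, Rξ⟩` for `R = (A-λ)⁻¹P_ρ`, `ρ > λ ≥ 0` (FL (3.14)–(3.15):
`‖A^{1/2}(A-λ)^{-1/2}P_ρ‖² ≤ ρ(ρ-λ)⁻¹`). [cite: FrohlichLieb1978, eqs. (3.14)–(3.15)] -/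
theorem IsHermitian.re_resolventGe_energy_le {A : Matrix n n ℂ} (hA : A.IsHermitian) {ρ lam : ℝ}
    (hlam : 0 ≤ lam) (hρ : lam < ρ) (ξ : n → ℂ) :
    (star (hA.resolventGe ρ lam *ᵥ ξ) ⬝ᵥ A *ᵥ (hA.resolventGe ρ lam *ᵥ ξ)).re ≤
      ρ * (ρ - lam)⁻¹ * (star ξ ⬝ᵥ hA.resolventGe ρ lam *ᵥ ξ).re := by
  have hR := hA.resolventGe_isHermitian ρ lam
  rw [fel_star_mulVec_dotProduct, hR.eq, mulVec_mulVec, mulVec_mulVec]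
  have hRAR : hA.resolventGe ρ lam * A * hA.resolventGe ρ lam =
      (hA.eigenvectorUnitary : Matrix n n ℂ) * diagonal (fun i =>
        (((if ρ ≤ hA.eigenvalues i then (hA.eigenvalues i - lam)⁻¹ else 0) ^ 2 *
          hA.eigenvalues i : ℝ) : ℂ)) * (hA.eigenvectorUnitary : Matrix n n ℂ)ᴴ := by
    have key : ∀ M : Matrix n n ℂ, M = (hA.eigenvectorUnitary : Matrix n n ℂ) *
        diagonal (fun i => ((hA.eigenvalues i : ℝ) : ℂ)) * (hA.eigenvectorUnitary : Matrix n n ℂ)ᴴ →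
        hA.resolventGe ρ lam * M * hA.resolventGe ρ lam =
          (hA.eigenvectorUnitary : Matrix n n ℂ) * diagonal (fun i =>
            (((if ρ ≤ hA.eigenvalues i then (hA.eigenvalues i - lam)⁻¹ else 0) ^ 2 *
              hA.eigenvalues i : ℝ) : ℂ)) * (hA.eigenvectorUnitary : Matrix n n ℂ)ᴴ := by
      intro M hM
      rw [hM, IsHermitian.resolventGe, fel_cfc_eq, fel_frame_mul, fel_frame_mul]
      exact fel_frame_congr hA fun i => by push_cast; ring
    exact key A (fel_self_eq hA)
  rw [hRAR, fel_frame_quad, Complex.ofReal_re, IsHermitian.resolventGe, fel_cfc_eq, fel_frame_quad,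
    Complex.ofReal_re, mul_sum]
  refine sum_le_sum fun i _ => ?_
  rw [← mul_assoc]
  refine mul_le_mul_of_nonneg_right ?_ (Complex.normSq_nonneg _)
  split_ifs with h
  · -- `a/(a-λ)² ≤ ρ/((ρ-λ)(a-λ))` for `a ≥ ρ > λ ≥ 0`
    have ha : 0 < hA.eigenvalues i - lam := by linarith
    have hρ' : 0 < ρ - lam := by linarith
    rw [← sub_nonneg]
    have hid : ρ * (ρ - lam)⁻¹ * (hA.eigenvalues i - lam)⁻¹ -
        (hA.eigenvalues i - lam)⁻¹ ^ 2 * hA.eigenvalues i =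
        (hA.eigenvalues i - lam)⁻¹ ^ 2 * (ρ - lam)⁻¹ * (lam * (hA.eigenvalues i - ρ)) := by
      field_simp
      ring
    rw [hid]
    exact mul_nonneg (mul_nonneg (sq_nonneg _) (inv_nonneg.2 hρ'.le))
      (mul_nonneg hlam (by linarith))
  · simp

end Spectral

/-! ### Theorem 3.1 -/

section Localization

variable {A B : Matrix n n ℂ}

/-- **The contraction (FL (3.15))**: for `T = B(A-λ)⁻¹P_ρ`, `R = (A-λ)⁻¹P_ρ` and every `χ`,
`⟨Tχ, R Tχ⟩ ≤ σ² ⟨χ, Rχ⟩`, `σ = ερ/(ρ-λ)`. [cite: FrohlichLieb1978, eqs. (3.13)–(3.15)] -/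
theorem re_resolventGe_contraction (hA : A.PosSemidef) (hB : B.IsHermitian) {ε : ℝ} (hε : 0 ≤ ε)
    (hBp : ((ε : ℂ) • A - B).PosSemidef) (hBm : ((ε : ℂ) • A + B).PosSemidef) {ρ lam : ℝ}
    (hlam : 0 ≤ lam) (hρ : lam < ρ) (χ : n → ℂ) :
    (star ((B * hA.1.resolventGe ρ lam) *ᵥ χ) ⬝ᵥ
        hA.1.resolventGe ρ lam *ᵥ ((B * hA.1.resolventGe ρ lam) *ᵥ χ)).re ≤
      (ε * ρ / (ρ - lam)) ^ 2 * (star χ ⬝ᵥ hA.1.resolventGe ρ lam *ᵥ χ).re := by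
  set R := hA.1.resolventGe ρ lam with hRdef
  set σ : ℝ := ε * ρ / (ρ - lam) with hσ
  have hR := hA.1.resolventGe_isHermitian ρ lam
  set η : n → ℂ := (B * R) *ᵥ χ with hη
  -- `t = ⟨BRχ, R BRχ⟩ = Re⟨Rχ, B (R η)⟩`
  have ht : (star η ⬝ᵥ R *ᵥ η).re = (star (R *ᵥ χ) ⬝ᵥ B *ᵥ (R *ᵥ η)).re := by
    rw [hη, ← mulVec_mulVec, fel_star_mulVec_dotProduct, hB.eq, mulVec_mulVec, mulVec_mulVec,
      mulVec_mulVec, Matrix.mul_assoc]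
  have ha0 := (hA.1.re_resolventGe_bounds hρ χ).1
  have ht0 := (hA.1.re_resolventGe_bounds hρ η).1
  have hEχ := hA.1.re_resolventGe_energy_le hlam hρ χ
  have hEη := hA.1.re_resolventGe_energy_le hlam hρ η
  have hρ' : 0 < ρ - lam := by linarith
  have hκ : 0 ≤ ρ * (ρ - lam)⁻¹ := mul_nonneg (by linarith) (inv_nonneg.2 hρ'.le)
  by_cases hσ0 : σ = 0
  · -- then `ε = 0`
    have hε0 : ε = 0 := by
      have hρ0 : 0 < ρ := by linarith
      rcases mul_eq_zero.1 ((div_eq_zero_iff).1 hσ0 |>.resolve_right hρ'.ne') with h | h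
      · exact h
      · exact absurd h hρ0.ne'
    have h := two_mul_re_le_of_pm_le hBp hBm (R *ᵥ χ) (R *ᵥ η) one_ne_zero
    rw [hε0, zero_mul, ← ht] at h
    rw [hσ0, sq, zero_mul, zero_mul]
    linarith
  · have hσpos : 0 < σ :=
      lt_of_le_of_ne (by rw [hσ]; exact div_nonneg (mul_nonneg hε (by linarith)) hρ'.le)
        (Ne.symm hσ0)
    set s : ℝ := Real.sqrt σ with hs
    have hs0 : s ≠ 0 := (Real.sqrt_pos.2 hσpos).ne'
    have hs2 : s ^ 2 = σ := Real.sq_sqrt hσpos.le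
    have h := two_mul_re_le_of_pm_le hBp hBm (R *ᵥ χ) (R *ᵥ η) hs0
    rw [← ht, hs2] at h
    -- `2t ≤ ε(σ κ a + σ⁻¹ κ t) = σ² a + t`
    have h2 : 2 * (star η ⬝ᵥ R *ᵥ η).re ≤
        ε * (σ * (ρ * (ρ - lam)⁻¹ * (star χ ⬝ᵥ R *ᵥ χ).re) +
          σ⁻¹ * (ρ * (ρ - lam)⁻¹ * (star η ⬝ᵥ R *ᵥ η).re)) := by
      refine h.trans (mul_le_mul_of_nonneg_left (add_le_add ?_ ?_) hε)
      · exact mul_le_mul_of_nonneg_left hEχ hσpos.le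
      · exact mul_le_mul_of_nonneg_left hEη (inv_nonneg.2 hσpos.le)
    have hid1 : ε * (σ * (ρ * (ρ - lam)⁻¹)) = σ ^ 2 := by
      rw [show ε * (σ * (ρ * (ρ - lam)⁻¹)) = σ * (ε * ρ / (ρ - lam)) by ring, ← hσ, sq]
    have hid2 : ε * (σ⁻¹ * (ρ * (ρ - lam)⁻¹)) = 1 := by
      rw [show ε * (σ⁻¹ * (ρ * (ρ - lam)⁻¹)) = σ⁻¹ * (ε * ρ / (ρ - lam)) by ring, ← hσ,
        inv_mul_cancel₀ hσ0]
    have e1 : ε * (σ * (ρ * (ρ - lam)⁻¹ * (star χ ⬝ᵥ R *ᵥ χ).re)) =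
        σ ^ 2 * (star χ ⬝ᵥ R *ᵥ χ).re := by
      rw [show ε * (σ * (ρ * (ρ - lam)⁻¹ * (star χ ⬝ᵥ R *ᵥ χ).re)) =
        (ε * (σ * (ρ * (ρ - lam)⁻¹))) * (star χ ⬝ᵥ R *ᵥ χ).re by ring, hid1]
    have e2 : ε * (σ⁻¹ * (ρ * (ρ - lam)⁻¹ * (star η ⬝ᵥ R *ᵥ η).re)) =
        (star η ⬝ᵥ R *ᵥ η).re := by
      rw [show ε * (σ⁻¹ * (ρ * (ρ - lam)⁻¹ * (star η ⬝ᵥ R *ᵥ η).re)) =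
        (ε * (σ⁻¹ * (ρ * (ρ - lam)⁻¹))) * (star η ⬝ᵥ R *ᵥ η).re by ring, hid2, one_mul]
    rw [mul_add, e1, e2] at h2
    linarith

/-- **Fröhlich–Lieb, Theorem 3.1 (exponential localization of eigenvectors).** Let `A ≥ 0` and
`B` be Hermitian matrices with `±B ≤ εA`, `0 ≤ ε < 1`; let `(A + B)ψ = λψ` with `‖ψ‖ = 1`; let
`ρ > λ ≥ 0` with `σ = ερ(ρ - λ)⁻¹ < 1`; let `P_ρ` be the spectral projection of `A` for `[ρ, ∞)`
(`M_ρ` its range) and `φ ∈ M_ρ` a unit vector such that `{B(A - λ)⁻¹}ʲφ ∈ M_ρ` for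
`j = 0, 1, …, d - 1`, `d ≥ 1` (here `(A-λ)⁻¹` is `resolventGe`, the inverse of `A - λ` on `M_ρ`).
Then `|⟨φ, ψ⟩| ≤ σ^d`. [cite: FrohlichLieb1978, Thm. 3.1, eqs. (3.9)–(3.17)] -/
theorem FrohlichLieb_exponentialLocalization (hA : A.PosSemidef) (hB : B.IsHermitian) {ε : ℝ}
    (hε0 : 0 ≤ ε) (hε1 : ε < 1) (hBp : ((ε : ℂ) • A - B).PosSemidef)
    (hBm : ((ε : ℂ) • A + B).PosSemidef) {ψ : n → ℂ} {lam : ℝ}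
    (hψ : (A + B) *ᵥ ψ = (lam : ℂ) • ψ) (hψ1 : star ψ ⬝ᵥ ψ = 1) {ρ : ℝ} (hlam : 0 ≤ lam)
    (hρ : lam < ρ) (hσ : ε * ρ / (ρ - lam) < 1) {φ : n → ℂ} (hφ1 : star φ ⬝ᵥ φ = 1) {d : ℕ}
    (hd : 1 ≤ d)
    (hiii : ∀ j < d, hA.1.spectralProjGe ρ *ᵥ ((B * hA.1.resolventGe ρ lam) ^ j *ᵥ φ) =
      (B * hA.1.resolventGe ρ lam) ^ j *ᵥ φ) :
    ‖star φ ⬝ᵥ ψ‖ ≤ (ε * ρ / (ρ - lam)) ^ d := by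
  set R := hA.1.resolventGe ρ lam with hRdef
  set T := B * R with hT
  set σ : ℝ := ε * ρ / (ρ - lam) with hσdef
  have hρ' : 0 < ρ - lam := by linarith
  have hσ0 : 0 ≤ σ := by
    rw [hσdef]; exact div_nonneg (mul_nonneg hε0 (by linarith)) hρ'.le
  -- (3.12') iterated: `⟨φ, ψ⟩ = ± ⟨T^k φ, ψ⟩`
  have hstep : ∀ k, k < d → star (T ^ k *ᵥ φ) ⬝ᵥ ψ = -(star (T ^ (k + 1) *ᵥ φ) ⬝ᵥ ψ) := by
    intro k hk
    rw [hA.1.dotProduct_eq_neg_resolventGe hρ hψ (hiii k hk), pow_succ' T k, ← mulVec_mulVec,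
      hT, ← mulVec_mulVec, fel_star_mulVec_dotProduct B, hB.eq]
  have hiter : ∀ k, k ≤ d - 1 → ‖star φ ⬝ᵥ ψ‖ = ‖star (T ^ k *ᵥ φ) ⬝ᵥ ψ‖ := by
    intro k hk
    induction k with
    | zero => rw [pow_zero, one_mulVec]
    | succ k ih =>
      rw [ih (by omega), hstep k (by omega), norm_neg]
  -- the contraction iterated: `⟨T^k φ, R T^k φ⟩ ≤ σ^{2k} (ρ-λ)⁻¹`
  have hcontr : ∀ k, (star (T ^ k *ᵥ φ) ⬝ᵥ R *ᵥ (T ^ k *ᵥ φ)).re ≤ (σ ^ 2) ^ k * (ρ - lam)⁻¹ := by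
    intro k
    induction k with
    | zero =>
      rw [pow_zero, one_mulVec, pow_zero, one_mul]
      have := (hA.1.re_resolventGe_bounds hρ φ).2
      rw [hφ1, Complex.one_re, mul_one] at this
      exact this
    | succ k ih =>
      rw [pow_succ' T k, ← mulVec_mulVec, hT]
      refine (re_resolventGe_contraction hA hB hε0 hBp hBm hlam hρ _).trans ?_
      rw [pow_succ (σ ^ 2) k, mul_comm ((σ ^ 2) ^ k) (σ ^ 2), mul_assoc]
      exact mul_le_mul_of_nonneg_left ih (sq_nonneg _)
  -- the last step (3.12)+(3.13): `|⟨φ,ψ⟩| = |⟨R χ, Bψ⟩|`, `χ = T^{d-1} φ`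
  set χ := T ^ (d - 1) *ᵥ φ with hχ
  have hlast : ‖star φ ⬝ᵥ ψ‖ = ‖star (R *ᵥ χ) ⬝ᵥ B *ᵥ ψ‖ := by
    rw [hiter (d - 1) le_rfl, hA.1.dotProduct_eq_neg_resolventGe hρ hψ (hiii (d - 1) (by omega)),
      norm_neg]
  -- `⟨ψ, Aψ⟩ ≤ ρ` (3.17)
  have hAψ : (star ψ ⬝ᵥ A *ᵥ ψ).re ≤ ρ := by
    have h0 := (Complex.nonneg_iff.1 (hBm.dotProduct_mulVec_nonneg ψ)).1
    rw [add_mulVec, smul_mulVec, dotProduct_add, dotProduct_smul, Complex.add_re, smul_eq_mul,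
      Complex.re_ofReal_mul] at h0
    have hl : (star ψ ⬝ᵥ A *ᵥ ψ).re + (star ψ ⬝ᵥ B *ᵥ ψ).re = lam := by
      rw [← Complex.add_re, ← dotProduct_add, ← add_mulVec, hψ, dotProduct_smul, smul_eq_mul,
        Complex.re_ofReal_mul, hψ1, Complex.one_re, mul_one]
    -- `(1-ε)⟨ψ,Aψ⟩ ≤ λ < ρ(1-ε)`
    have h1 : (1 - ε) * (star ψ ⬝ᵥ A *ᵥ ψ).re ≤ lam := by linarith
    have h2 : lam ≤ (1 - ε) * ρ := by
      have := (div_lt_one hρ').1 hσ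
      nlinarith
    have h1e : 0 < 1 - ε := by linarith
    exact le_of_mul_le_mul_left (h1.trans h2) h1e
  have hRχA : (star (R *ᵥ χ) ⬝ᵥ A *ᵥ (R *ᵥ χ)).re ≤
      ρ * (ρ - lam)⁻¹ * ((σ ^ 2) ^ (d - 1) * (ρ - lam)⁻¹) :=
    (hA.1.re_resolventGe_energy_le hlam hρ χ).trans
      (mul_le_mul_of_nonneg_left (hcontr (d - 1))
        (mul_nonneg (by linarith) (inv_nonneg.2 hρ'.le)))
  rw [hlast]
  by_cases hσz : σ = 0
  · have hε : ε = 0 := by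
      have hρ0 : 0 < ρ := by linarith
      rcases mul_eq_zero.1 ((div_eq_zero_iff).1 hσz |>.resolve_right hρ'.ne') with h | h
      · exact h
      · exact absurd h hρ0.ne'
    have h := two_mul_norm_le_of_pm_le hBp hBm (R *ᵥ χ) ψ one_ne_zero
    rw [hε, zero_mul] at h
    have : ‖star (R *ᵥ χ) ⬝ᵥ B *ᵥ ψ‖ = 0 := le_antisymm (by linarith) (norm_nonneg _)
    rw [this]
    positivity
  · have hσpos : 0 < σ := lt_of_le_of_ne hσ0 (Ne.symm hσz)
    -- `s² = (ρ-λ)/σ^{d-1}`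
    set s : ℝ := Real.sqrt ((ρ - lam) / σ ^ (d - 1)) with hs
    have hq : 0 < (ρ - lam) / σ ^ (d - 1) := div_pos hρ' (pow_pos hσpos _)
    have hs0 : s ≠ 0 := (Real.sqrt_pos.2 hq).ne'
    have hs2 : s ^ 2 = (ρ - lam) / σ ^ (d - 1) := Real.sq_sqrt hq.le
    have h := two_mul_norm_le_of_pm_le hBp hBm (R *ᵥ χ) ψ hs0
    rw [hs2] at h
    have hb : ε * ((ρ - lam) / σ ^ (d - 1) * (star (R *ᵥ χ) ⬝ᵥ A *ᵥ (R *ᵥ χ)).re +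
        ((ρ - lam) / σ ^ (d - 1))⁻¹ * (star ψ ⬝ᵥ A *ᵥ ψ).re) ≤
        ε * ((ρ - lam) / σ ^ (d - 1) * (ρ * (ρ - lam)⁻¹ * ((σ ^ 2) ^ (d - 1) * (ρ - lam)⁻¹)) +
          ((ρ - lam) / σ ^ (d - 1))⁻¹ * ρ) :=
      mul_le_mul_of_nonneg_left (add_le_add (mul_le_mul_of_nonneg_left hRχA hq.le)
        (mul_le_mul_of_nonneg_left hAψ (inv_nonneg.2 hq.le))) hε0
    have hval :
        ε * ((ρ - lam) / σ ^ (d - 1) * (ρ * (ρ - lam)⁻¹ * ((σ ^ 2) ^ (d - 1) * (ρ - lam)⁻¹)) +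
        ((ρ - lam) / σ ^ (d - 1))⁻¹ * ρ) = 2 * σ ^ d := by
      obtain ⟨d', rfl⟩ : ∃ d', d = d' + 1 := ⟨d - 1, by omega⟩
      have hp : σ ^ d' ≠ 0 := pow_ne_zero _ hσpos.ne'
      simp only [Nat.add_sub_cancel]
      rw [pow_right_comm, pow_succ σ d']
      generalize σ ^ d' = p at hp ⊢
      rw [hσdef]
      field_simp
      ring
    linarith [hb.trans_eq hval, h]

/-- **Fröhlich–Lieb, Corollary 3.2.** In the setting of Theorem 3.1, let `Q` be the orthogonal
projection onto a subspace `N ⊆ M_ρ` each of whose vectors `φ` satisfies hypothesis (iii)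
(`{B(A-λ)⁻¹}ʲφ ∈ M_ρ`, `j < d`). Then `⟨ψ, Qψ⟩ ≤ σ^{2d}`.
[cite: FrohlichLieb1978, Cor. 3.2] -/
theorem FrohlichLieb_exponentialLocalization_proj (hA : A.PosSemidef) (hB : B.IsHermitian)
    {ε : ℝ} (hε0 : 0 ≤ ε) (hε1 : ε < 1) (hBp : ((ε : ℂ) • A - B).PosSemidef)
    (hBm : ((ε : ℂ) • A + B).PosSemidef) {ψ : n → ℂ} {lam : ℝ}
    (hψ : (A + B) *ᵥ ψ = (lam : ℂ) • ψ) (hψ1 : star ψ ⬝ᵥ ψ = 1) {ρ : ℝ} (hlam : 0 ≤ lam)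
    (hρ : lam < ρ) (hσ : ε * ρ / (ρ - lam) < 1) {Q : Matrix n n ℂ} (hQ : Q.IsHermitian)
    (hQ2 : Q * Q = Q) {d : ℕ} (hd : 1 ≤ d)
    (hiii : ∀ φ : n → ℂ, Q *ᵥ φ = φ → ∀ j < d,
      hA.1.spectralProjGe ρ *ᵥ ((B * hA.1.resolventGe ρ lam) ^ j *ᵥ φ) =
        (B * hA.1.resolventGe ρ lam) ^ j *ᵥ φ) :
    (star ψ ⬝ᵥ Q *ᵥ ψ).re ≤ (ε * ρ / (ρ - lam)) ^ (2 * d) := by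
  set w : n → ℂ := Q *ᵥ ψ with hw
  have hQw : Q *ᵥ w = w := by rw [hw, mulVec_mulVec, hQ2]
  -- `⟨ψ, Qψ⟩ = ‖w‖²`
  have hform : star ψ ⬝ᵥ Q *ᵥ ψ = star w ⬝ᵥ w := by
    rw [hw, fel_star_mulVec_dotProduct, hQ.eq, mulVec_mulVec, hQ2]
  set r : ℝ := (star w ⬝ᵥ w).re with hr
  have hr0 : 0 ≤ r := by
    rw [hr, fel_star_dotProduct_self, Complex.ofReal_re]
    exact sum_nonneg fun i _ => Complex.normSq_nonneg _
  have hwr : star w ⬝ᵥ w = (r : ℂ) := by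
    rw [hr, fel_star_dotProduct_self, Complex.ofReal_re]
  rw [hform, hwr, Complex.ofReal_re]
  by_cases hr00 : r = 0
  · rw [hr00, pow_mul]; positivity
  · have hrpos : 0 < r := lt_of_le_of_ne hr0 (Ne.symm hr00)
    -- normalise `φ = w/√r`
    set φ : n → ℂ := ((Real.sqrt r)⁻¹ : ℂ) • w with hφ
    have hsq : Real.sqrt r ^ 2 = r := Real.sq_sqrt hr0
    have hsq0 : Real.sqrt r ≠ 0 := (Real.sqrt_pos.2 hrpos).ne'
    have hφ1 : star φ ⬝ᵥ φ = 1 := by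
      rw [hφ, star_smul, smul_dotProduct, dotProduct_smul, smul_smul, hwr, smul_eq_mul,
        ← Complex.ofReal_inv, Complex.star_def, Complex.conj_ofReal, ← Complex.ofReal_mul,
        ← Complex.ofReal_mul, ← Complex.ofReal_one]
      congr 1
      field_simp
      rw [hsq]
    have hQφ : Q *ᵥ φ = φ := by rw [hφ, mulVec_smul, hQw]
    have hmain := FrohlichLieb_exponentialLocalization hA hB hε0 hε1 hBp hBm hψ hψ1 hlam hρ hσ hφ1
      hd (hiii φ hQφ)
    -- `⟨φ, ψ⟩ = √r`
    have hφψ : star φ ⬝ᵥ ψ = (Real.sqrt r : ℂ) := by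
      rw [hφ, star_smul, smul_dotProduct, hw, fel_star_mulVec_dotProduct, hQ.eq, hform, hwr,
        smul_eq_mul, ← Complex.ofReal_inv, Complex.star_def, Complex.conj_ofReal,
        ← Complex.ofReal_mul]
      congr 1
      field_simp
      rw [hsq]
    rw [hφψ, Complex.norm_real, Real.norm_of_nonneg (Real.sqrt_nonneg _)] at hmain
    calc r = Real.sqrt r ^ 2 := hsq.symm
      _ ≤ ((ε * ρ / (ρ - lam)) ^ d) ^ 2 :=
          pow_le_pow_left₀ (Real.sqrt_nonneg _) hmain 2
      _ = (ε * ρ / (ρ - lam)) ^ (2 * d) := by rw [mul_comm 2 d, pow_mul]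

end Localization

/-! ### Verifying hypothesis (ii) by a unitary antisymmetry (FL (3.22)–(3.23)) -/

section Antisymmetry

omit [DecidableEq n] in
/-- **FL (3.22)–(3.23): `±B ≤ εA` from a unitary antisymmetry.** If `εA + B ≥ 0` and there is a
matrix `V` with `V Vᴴ = 1` fixing `A` and reversing `B` under conjugation (`VAVᴴ = A`,
`VBVᴴ = -B` — for the anisotropic antiferromagnet, the rotation of all spins of one sublattice by
`π` about the `z`-axis takes `H^{xy}` to `-H^{xy}` and fixes `H^z`), then also `εA - B ≥ 0`,
i.e. `±B ≤ εA`. [cite: FrohlichLieb1978, eqs. (3.22)–(3.23)] -/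
theorem posSemidef_smul_sub_of_conj_antisymm {A B V : Matrix n n ℂ} {ε : ℝ}
    (hVA : V * A * Vᴴ = A) (hVB : V * B * Vᴴ = -B) (hBm : ((ε : ℂ) • A + B).PosSemidef) :
    ((ε : ℂ) • A - B).PosSemidef := by
  have h := hBm.mul_mul_conjTranspose_same V
  rwa [Matrix.mul_add, Matrix.add_mul, Matrix.mul_smul, Matrix.smul_mul, hVA, hVB,
    ← sub_eq_add_neg] at h

omit [DecidableEq n] in
/-- The symmetric statement: a unitary antisymmetry turns `εA - B ≥ 0` into `εA + B ≥ 0`.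
[cite: FrohlichLieb1978, eqs. (3.22)–(3.23)] -/
theorem posSemidef_smul_add_of_conj_antisymm {A B V : Matrix n n ℂ} {ε : ℝ}
    (hVA : V * A * Vᴴ = A) (hVB : V * B * Vᴴ = -B) (hBp : ((ε : ℂ) • A - B).PosSemidef) :
    ((ε : ℂ) • A + B).PosSemidef := by
  have h := hBp.mul_mul_conjTranspose_same V
  rwa [Matrix.mul_sub, Matrix.sub_mul, Matrix.mul_smul, Matrix.smul_mul, hVA, hVB,
    sub_neg_eq_add] at h

omit [DecidableEq n] in
/-- **FL (3.22)–(3.23) packaged**: from `A + ε⁻¹B ≥ 0` (`ε > 0`; FL's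
`A + α⁻¹B = S⁻²(H^z + H^{xy}) - e₀(1) ≥ 0`, (3.22)) and a unitary antisymmetry
(`VAVᴴ = A`, `VBVᴴ = -B`), both `εA + B ≥ 0` and `εA - B ≥ 0`, i.e. `±B ≤ εA` ((3.23),
`ε = α`). [cite: FrohlichLieb1978, eqs. (3.22)–(3.23)] -/
theorem pm_le_of_conj_antisymm {A B V : Matrix n n ℂ} {ε : ℝ} (hε : 0 < ε)
    (hVA : V * A * Vᴴ = A) (hVB : V * B * Vᴴ = -B) (hsum : (A + ((ε⁻¹ : ℝ) : ℂ) • B).PosSemidef) :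
    ((ε : ℂ) • A + B).PosSemidef ∧ ((ε : ℂ) • A - B).PosSemidef := by
  have hBm : ((ε : ℂ) • A + B).PosSemidef := by
    have h := hsum.smul (Complex.zero_le_real.2 hε.le)
    rwa [smul_add, smul_smul, ← Complex.ofReal_mul, mul_inv_cancel₀ hε.ne', Complex.ofReal_one,
      one_smul] at h
  exact ⟨hBm, posSemidef_smul_sub_of_conj_antisymm hVA hVB hBm⟩

end Antisymmetry


end Matrix

end
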